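import Summits.AtomisticToContinuum.Crystallization.Theorems.ThreeConeCertificateKeplerBoundOfBulkDefectVanish
import Summits.AtomisticToContinuum.Crystallization.Theorems.ChargedEnergyGap.Negative.BlocksLocal
import Summits.AtomisticToContinuum.Crystallization.Theorems.ChargedEnergyGap.Negative.Unconditional
import HarnessLib

/-!
# `SlackRigidity` (stmt-AtomisticToContinuum-11960) pins the periodic minimisers

Support file for the crux `ThreeConeCertificate.SlackRigidity` (line `ekeland-surgery-parity`,
registered necessary-condition stub `slackRigidity_pins_minimisers` of lead c10, proved by lead c12).

MAIN RESULT (`slackRigidity_pins_minimisers`).  If `SlackRigidity` holds with witness `P`, then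

* `P` is a periodic Lennard-Jones minimiser: `e(P) ≤ e(Q)` for every periodic configuration `Q` of
  `ℝ³` (this half is the tree theorem `KeplerBoundBulk.isLeast_of_gsRigid`, tested on ground states);
* EVERY periodic minimiser `Q` (`e(Q) = min_Q' e(Q')`) is, at EVERY site `s ∈ Q.points` and every
  window radius `R` and tolerance `ε`, two-way `ε`-matched to `s + A(P.points)` for a linear isometry
  `A` (`siteMatched_of_rigidFor`).

So the crux forces all periodic minimisers to be locally congruent, at every site and every scale,
to ONE template: an exact tie between two periodic Lennard-Jones minimisers with non-congruent local
environments (e.g. an fcc/hcp tie: cuboctahedral vs anticuboctahedral 12-shells), or a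
non-vertex-transitive optimal polytype, refutes `SlackRigidity` while plain crystallisation could
survive.  This is the formal content of the route's `why_might_fail: exact polytype tie`.

MECHANISM (`siteMatched_of_rigidFor`).  Let `Q` be a periodic minimiser, so `e(Q) = e* = ⨅ e`
(`energyPerParticle_eq_eStar_of_min`).  The blocks `F + {Σ kᵢ bᵢ : 0 ≤ kᵢ < K}` of `Q`
(`Blocks.blockConfig`, `#F·K³` points) are trial states with `E(block_K) ≤ #F K³ (e(Q) + o(1))`
(`Blocks.exists_block_energy_le`) while `E(N) ≥ N e*` (`eStar_le_groundStateEnergy_div`); filling the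
other sizes `N` with ground states gives an injective sequence with excess `o(N)`
(`exists_blockSeq`).  `SlackRigidity` makes its bad fraction vanish.  But if the site `s = y + g` of
`Q` were NOT matched to `P`, then in the block every particle `y + Σ kᵢbᵢ` with DEEP coordinates `k`
(`Blocks.IsDeep K (depth Q (R+1)) k`: its `(R+1)`-neighbourhood in `Q` lies inside the block,
`Blocks.exists_eq_toP_of_dist_lt`) is bad, by lattice-translation covariance of the matching
(`siteMatched_of_good`); deep coordinates number `≥ K³ − 6·depth·K²` (`Blocks.card_not_deep_le`), so the
bad fraction along the block sizes stays `≥ 1/(2#F)` (`card_deep_le_badCount`,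
`false_of_badFractionVanishes`) — a contradiction.  All `[folklore]`.
-/

noncomputable section

open scoped BigOperators Topology
open Filter Set Metric

namespace Summit.AtomisticToContinuum.Crystallization.Theorems.SlackRigidityPinsMinimisers

open Literature.MathematicalPhysics.StatisticalMechanics
open Summit.AtomisticToContinuum.Crystallization.Theses.ThreeConeCertificate (SlackRigidity)
open Summit.AtomisticToContinuum.Crystallization.Theorems.SlackRigidityNegative
open Summit.AtomisticToContinuum.Crystallization.Theorems.ChargedEnergyGapNegative
  (eStar eStar_le eStar_le_groundStateEnergy_div)
open Summit.AtomisticToContinuum.Crystallization.Theorems.ChargedEnergyGapNegative.Blocks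

/-! ## § Block sizes -/

/-- The block sizes `K ↦ #F · K³` are strictly increasing. [folklore] -/
theorem card_BIdx_strictMono (Q : PeriodicConfiguration 3) :
    StrictMono fun K : ℕ => Fintype.card (BIdx Q K) := by
  have hF : 0 < Q.motif.card := Q.motif_nonempty.card_pos
  intro K K' h
  simp only [card_BIdx]
  exact Nat.mul_lt_mul_of_pos_left (Nat.pow_left_strictMono (by norm_num) h) hF

/-- Hence the block size determines `K`. [folklore] -/
theorem card_BIdx_injective (Q : PeriodicConfiguration 3) :
    Function.Injective fun K : ℕ => Fintype.card (BIdx Q K) :=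
  (card_BIdx_strictMono Q).injective

/-- Re-indexing a block along an equality of block sizes gives back the block. [folklore] -/
theorem blockConfig_cast_eq (Q : PeriodicConfiguration 3) {K K' : ℕ}
    (h : Fintype.card (BIdx Q K') = Fintype.card (BIdx Q K)) :
    (fun i => blockConfig Q K' (Fin.cast h.symm i)) = blockConfig Q K := by
  obtain rfl : K' = K := card_BIdx_injective Q h
  rfl

/-- A periodic minimiser has energy per particle `e* = ⨅_Q e(Q)`. [folklore] -/
theorem energyPerParticle_eq_eStar_of_min {Q : PeriodicConfiguration 3}
    (hQ : ∀ Q' : PeriodicConfiguration 3,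
      Q.energyPerParticle lennardJones ≤ Q'.energyPerParticle lennardJones) :
    Q.energyPerParticle lennardJones = eStar := by
  refine le_antisymm ?_ (eStar_le Q)
  show _ ≤ ⨅ Q' : PeriodicConfiguration 3, Q'.energyPerParticle lennardJones
  exact le_ciInf hQ

/-! ## § The test sequence: blocks of a periodic minimiser, ground states elsewhere -/

/-- **Blocks of a periodic minimiser form an admissible sequence.** For a periodic `Q` with
`e(Q) = e*` there is an injective sequence `x N : Fin N → ℝ³` with energy excess `o(N)` which at
every block size `N = #F·K³` IS the block `blockConfig Q K` (elsewhere it is a ground state).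
[folklore] -/
theorem exists_blockSeq (Q : PeriodicConfiguration 3)
    (hQ : Q.energyPerParticle lennardJones = eStar) :
    ∃ x : (N : ℕ) → Fin N → E3, (∀ N, Function.Injective (x N)) ∧ ExcessVanishes x ∧
      ∀ K, x (Fintype.card (BIdx Q K)) = blockConfig Q K := by
  classical
  obtain ⟨x, hx⟩ : ∃ x : (N : ℕ) → Fin N → E3, ∀ N, x N =
      if h : ∃ K, Fintype.card (BIdx Q K) = N then
        fun i => blockConfig Q (Classical.choose h) (Fin.cast (Classical.choose_spec h).symm i)
      else gs N := ⟨_, fun N => rfl⟩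
  have hblock : ∀ K, x (Fintype.card (BIdx Q K)) = blockConfig Q K := by
    intro K
    have h : ∃ K', Fintype.card (BIdx Q K') = Fintype.card (BIdx Q K) := ⟨K, rfl⟩
    rw [hx, dif_pos h]
    exact blockConfig_cast_eq Q (Classical.choose_spec h)
  have hother : ∀ N, (¬ ∃ K, Fintype.card (BIdx Q K) = N) → x N = gs N := fun N h => by
    rw [hx, dif_neg h]
  refine ⟨x, fun N => ?_, ?_, hblock⟩
  · by_cases h : ∃ K, Fintype.card (BIdx Q K) = N
    · obtain ⟨K, rfl⟩ := h
      rw [hblock K]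
      exact blockConfig_injective Q K
    · rw [hother N h]
      exact gs_injective N
  · rw [ExcessVanishes, Metric.tendsto_atTop]
    intro δ hδ
    obtain ⟨K₀, hK₀, hKb⟩ := exists_block_energy_le Q (half_pos hδ)
    refine ⟨Fintype.card (BIdx Q K₀), fun N hN => ?_⟩
    have hN₀ : 0 < Fintype.card (BIdx Q K₀) := by
      rw [card_BIdx]; exact Nat.mul_pos Q.motif_nonempty.card_pos (pow_pos hK₀ 3)
    have hNpos : 0 < N := lt_of_lt_of_le hN₀ hN
    have hNr : (0 : ℝ) < N := by exact_mod_cast hNpos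
    rw [Real.dist_eq, sub_zero]
    by_cases h : ∃ K, Fintype.card (BIdx Q K) = N
    · obtain ⟨K, rfl⟩ := h
      rw [hblock K]
      have hKK₀ : K₀ ≤ K := by
        by_contra hlt
        push Not at hlt
        exact absurd hN (not_le.2 (card_BIdx_strictMono Q hlt))
      have hE := hKb K hKK₀
      have hlow := groundStateEnergy_lennardJones_le (d := 3) (blockConfig_injective Q K)
      have hes := eStar_le_groundStateEnergy_div hNpos
      rw [le_div_iff₀ hNr] at hes
      rw [hQ] at hE
      rw [abs_lt]
      constructor
      · have h0 : 0 ≤ (interactionEnergy lennardJones (blockConfig Q K) -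
            groundStateEnergy lennardJones 3 (Fintype.card (BIdx Q K))) /
              ((Fintype.card (BIdx Q K) : ℕ) : ℝ) := div_nonneg (by linarith) hNr.le
        linarith
      · rw [div_lt_iff₀ hNr]
        nlinarith
    · rw [hother N h, (gs_isGroundState N).2, sub_self, zero_div, abs_zero]
      exact hδ

/-! ## § Deep block particles of an unmatched site are bad -/

/-- **Lattice-translation covariance of the matching, inside a block.** If the block particle
`y + Σ kᵢbᵢ` with `(depth Q (R+1))`-deep coordinates `k` is `(R, ε)`-good for the template `P₀` in
the block configuration, then the site `y + g` of `Q` (any period `g`) is two-way `ε`-matched to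
`P₀` in the infinite configuration `Q`: the good particle's `R`-neighbourhood in the block is its
`R`-neighbourhood in `Q` (`exists_eq_toP_of_dist_lt`), and both are the translate of the
`R`-neighbourhood of `y + g`. [folklore] -/
theorem siteMatched_of_good {P₀ Q : PeriodicConfiguration 3} {R ε : ℝ}
    {y : E3} (hy : y ∈ Q.motif) {g : E3} (hg : g ∈ Q.lattice) {K : ℕ} {k : Fin 3 → Fin K}
    (hk : IsDeep K (depth Q (R + 1)) k)
    (hgood : Good P₀ R ε (blockConfig Q K) (Fintype.equivFin (BIdx Q K) (⟨y, hy⟩, k))) :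
    ∃ A : E3 →ₗᵢ[ℝ] E3,
      (∀ p ∈ P₀.points, ‖p‖ ≤ R → ∃ q ∈ Q.points, dist q (y + g + A p) ≤ ε) ∧
      (∀ q ∈ Q.points, dist q (y + g) ≤ R → ∃ p ∈ P₀.points, dist q (y + g + A p) ≤ ε) := by
  classical
  set u : BIdx Q K := (⟨y, hy⟩, k) with hu
  set t : E3 := latVec Q (coords K k) - g with ht
  have htmem : t ∈ Q.lattice := Q.lattice.sub_mem (latVec_mem Q _) hg
  have hst : y + g + t = bpt Q K u := by
    simp only [ht, hu, bpt]
    abel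
  have hxu : blockConfig Q K (Fintype.equivFin (BIdx Q K) u) = bpt Q K u := by
    rw [blockConfig_apply, Equiv.symm_apply_apply]
  have hdist : ∀ q z : E3, dist q (y + g + z) = dist (q + t) (bpt Q K u + z) := fun q z => by
    rw [← hst, show y + g + t + z = (y + g + z) + t by abel, dist_add_right]
  obtain ⟨A, h1, h2⟩ := hgood
  rw [hxu] at h1 h2
  refine ⟨A, fun p hp hpR => ?_, fun q hq hqR => ?_⟩
  · obtain ⟨j, hj⟩ := h1 p hp hpR
    refine ⟨blockConfig Q K j - t, ?_, ?_⟩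
    · rw [sub_eq_add_neg, blockConfig_apply]
      exact Q.add_mem_points (bpt_mem Q K _) (Q.lattice.neg_mem htmem)
    · rw [hdist, sub_add_cancel]
      exact hj
  · have hq' : q + t ∈ Q.points := Q.add_mem_points hq htmem
    have hqd : dist (q + t) (bpt Q K u) ≤ R := by
      have e := hdist q 0
      rw [add_zero, add_zero] at e
      rw [← e]
      exact hqR
    -- `q + t` is a block point: `bpt u` itself or, by deepness, another block point
    obtain ⟨j, hj⟩ : ∃ j, blockConfig Q K j = q + t := by
      by_cases heq : q + t = bpt Q K u
      · exact ⟨Fintype.equivFin (BIdx Q K) u, by rw [hxu, heq]⟩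
      · have hne : (⟨q + t, hq'⟩ : Q.points) ≠ toP Q K u := fun h => heq (congrArg Subtype.val h)
        obtain ⟨v, -, hv⟩ := exists_eq_toP_of_dist_lt Q K hk ⟨q + t, hq'⟩ hne
          (by rw [dist_comm]; exact lt_of_le_of_lt hqd (lt_add_one R))
        exact ⟨Fintype.equivFin (BIdx Q K) v, by
          rw [blockConfig_apply, Equiv.symm_apply_apply]; exact congrArg Subtype.val hv⟩
    obtain ⟨p, hp, hjp⟩ := h2 j (by rw [hj]; exact hqd)
    exact ⟨p, hp, by rw [hdist, ← hj]; exact hjp⟩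

/-- **Counting.** If the site `y + g` of `Q` is NOT matched to `P₀` at `(R, ε)`, then in the block of
side `K` at least `K³ − 6·depth·K²` particles are bad (all `y + Σ kᵢbᵢ` with deep `k`;
`Blocks.card_not_deep_le`). [folklore] -/
theorem card_deep_le_badCount {P₀ Q : PeriodicConfiguration 3} {R ε : ℝ}
    {y : E3} (hy : y ∈ Q.motif) {g : E3} (hg : g ∈ Q.lattice) (K : ℕ)
    (hs : ¬ ∃ A : E3 →ₗᵢ[ℝ] E3,
      (∀ p ∈ P₀.points, ‖p‖ ≤ R → ∃ q ∈ Q.points, dist q (y + g + A p) ≤ ε) ∧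
      (∀ q ∈ Q.points, dist q (y + g) ≤ R → ∃ p ∈ P₀.points, dist q (y + g + A p) ≤ ε)) :
    (K : ℝ) ^ 3 - 6 * (depth Q (R + 1) : ℝ) * (K : ℝ) ^ 2 ≤
      (badCount P₀ R ε (blockConfig Q K) : ℝ) := by
  classical
  set ρ' : ℕ := depth Q (R + 1) with hρ'
  -- deep coordinates inject into bad particles
  let f : {k : Fin 3 → Fin K // IsDeep K ρ' k} → {i // ¬ Good P₀ R ε (blockConfig Q K) i} :=
    fun k => ⟨Fintype.equivFin (BIdx Q K) (⟨y, hy⟩, k.1),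
      fun hgood => hs (siteMatched_of_good hy hg k.2 hgood)⟩
  have hf : Function.Injective f := by
    intro a b hab
    have h1 : Fintype.equivFin (BIdx Q K) (⟨y, hy⟩, a.1) =
        Fintype.equivFin (BIdx Q K) (⟨y, hy⟩, b.1) := congrArg Subtype.val hab
    exact Subtype.ext (Prod.ext_iff.1 ((Fintype.equivFin (BIdx Q K)).injective h1)).2
  have hle := Fintype.card_le_of_injective f hf
  -- deep coordinates are all but `≤ 6ρ'K²`
  have hcompl := Fintype.card_subtype_compl (fun k : Fin 3 → Fin K => IsDeep K ρ' k)
  have hsub := Fintype.card_subtype_le (fun k : Fin 3 → Fin K => IsDeep K ρ' k)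
  have hall : Fintype.card (Fin 3 → Fin K) = K ^ 3 := by
    rw [Fintype.card_fun, Fintype.card_fin, Fintype.card_fin]
  have hnd : Fintype.card {k : Fin 3 → Fin K // ¬ IsDeep K ρ' k} ≤ 6 * ρ' * K ^ 2 := by
    rw [Fintype.card_subtype]
    exact card_not_deep_le K ρ'
  rw [hall] at hcompl hsub
  have hdeep : K ^ 3 ≤ Fintype.card {k : Fin 3 → Fin K // IsDeep K ρ' k} + 6 * ρ' * K ^ 2 := by
    omega
  have hbad : badCount P₀ R ε (blockConfig Q K) =
      Fintype.card {i // ¬ Good P₀ R ε (blockConfig Q K) i} := by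
    rw [badCount, Nat.card_eq_fintype_card]
  rw [hbad]
  have h1 : ((K ^ 3 : ℕ) : ℝ) ≤
      (Fintype.card {k : Fin 3 → Fin K // IsDeep K ρ' k} : ℝ) + ((6 * ρ' * K ^ 2 : ℕ) : ℝ) := by
    exact_mod_cast hdeep
  have h2 : (Fintype.card {k : Fin 3 → Fin K // IsDeep K ρ' k} : ℝ) ≤
      (Fintype.card {i // ¬ Good P₀ R ε (blockConfig Q K) i} : ℝ) := by exact_mod_cast hle
  push_cast at h1
  linarith

/-- **The contradiction.** If the site `y + g` of `Q` is unmatched, no sequence that is the block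
`blockConfig Q K` at every block size `#F·K³` has vanishing bad fraction: along the block sizes the
bad fraction stays `≥ 1/(2#F)`. [folklore] -/
theorem false_of_badFractionVanishes {P₀ Q : PeriodicConfiguration 3} {R ε : ℝ}
    {y : E3} (hy : y ∈ Q.motif) {g : E3} (hg : g ∈ Q.lattice)
    (hs : ¬ ∃ A : E3 →ₗᵢ[ℝ] E3,
      (∀ p ∈ P₀.points, ‖p‖ ≤ R → ∃ q ∈ Q.points, dist q (y + g + A p) ≤ ε) ∧
      (∀ q ∈ Q.points, dist q (y + g) ≤ R → ∃ p ∈ P₀.points, dist q (y + g + A p) ≤ ε))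
    {x : (N : ℕ) → Fin N → E3} (hxK : ∀ K, x (Fintype.card (BIdx Q K)) = blockConfig Q K)
    (hT : BadFractionVanishes P₀ R ε x) : False := by
  set F : ℕ := Q.motif.card with hF
  have hF1 : 1 ≤ F := Q.motif_nonempty.card_pos
  have hFr : (0 : ℝ) < F := by exact_mod_cast hF1
  set ρ' : ℕ := depth Q (R + 1) with hρ'
  -- along the block sizes the bad fraction tends to `0` …
  have hT' : Tendsto (fun K : ℕ => (badCount P₀ R ε (x (Fintype.card (BIdx Q K))) : ℝ) /
      ((Fintype.card (BIdx Q K) : ℕ) : ℝ)) atTop (𝓝 0) :=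
    hT.comp (card_BIdx_strictMono Q).tendsto_atTop
  have hc : (0 : ℝ) < 1 / (2 * F) := by positivity
  have hev : ∀ᶠ K : ℕ in atTop, (badCount P₀ R ε (x (Fintype.card (BIdx Q K))) : ℝ) /
      ((Fintype.card (BIdx Q K) : ℕ) : ℝ) < 1 / (2 * F) :=
    hT'.eventually (gt_mem_nhds hc)
  obtain ⟨K, hK, hK1, hK12⟩ :=
    (hev.and ((eventually_ge_atTop 1).and (eventually_ge_atTop (12 * ρ')))).exists
  -- … but at a large block size it is at least `1/(2#F)`
  have hbad := card_deep_le_badCount hy hg K hs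
  rw [hxK K] at hK
  have hN : ((Fintype.card (BIdx Q K) : ℕ) : ℝ) = F * (K : ℝ) ^ 3 := by
    rw [card_BIdx]; push_cast; ring
  rw [hN] at hK
  have hKr : (1 : ℝ) ≤ K := by exact_mod_cast hK1
  have hK12r : 12 * (ρ' : ℝ) ≤ K := by exact_mod_cast hK12
  have hK3 : (0 : ℝ) < F * (K : ℝ) ^ 3 := by positivity
  rw [div_lt_iff₀ hK3] at hK
  have h6 : 6 * (ρ' : ℝ) * (K : ℝ) ^ 2 ≤ (K : ℝ) ^ 3 / 2 := by
    have hK2 : (0 : ℝ) ≤ (K : ℝ) ^ 2 := sq_nonneg _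
    nlinarith
  have hid : 1 / (2 * (F : ℝ)) * (F * (K : ℝ) ^ 3) = (K : ℝ) ^ 3 / 2 := by
    field_simp
  rw [hid] at hK
  linarith

/-! ## § Main results -/

/-- **Every periodic minimiser is locally the witness, at every site and every scale.** If `P₀`
witnesses `SlackRigidity` (`RigidFor P₀`) and `Q` is a periodic Lennard-Jones minimiser, then for every
site `s ∈ Q.points` and all `R, ε > 0` there is a linear isometry `A` with `Q ∩ B_R(s)` two-way
`ε`-matched to `s + A(P₀.points)`. [folklore] -/
theorem siteMatched_of_rigidFor {P₀ : PeriodicConfiguration 3} (hP₀ : RigidFor P₀)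
    {Q : PeriodicConfiguration 3}
    (hQ : ∀ Q' : PeriodicConfiguration 3,
      Q.energyPerParticle lennardJones ≤ Q'.energyPerParticle lennardJones)
    {s : E3} (hs : s ∈ Q.points) {R ε : ℝ} (hR : 0 < R) (hε : 0 < ε) :
    ∃ A : E3 →ₗᵢ[ℝ] E3,
      (∀ p ∈ P₀.points, ‖p‖ ≤ R → ∃ q ∈ Q.points, dist q (s + A p) ≤ ε) ∧
      (∀ q ∈ Q.points, dist q s ≤ R → ∃ p ∈ P₀.points, dist q (s + A p) ≤ ε) := by
  obtain ⟨y, hy, g, hg, rfl⟩ := hs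
  by_contra hneg
  obtain ⟨x, hinj, hexc, hxK⟩ := exists_blockSeq Q (energyPerParticle_eq_eStar_of_min hQ)
  exact false_of_badFractionVanishes hy hg hneg hxK (hP₀ R ε hR hε x hinj hexc)

/-- **A witness of `SlackRigidity` is a periodic minimiser** (the tree theorem
`KeplerBoundBulk.isLeast_of_gsRigid`, tested along the canonical ground states `gs`). [folklore] -/
theorem energyPerParticle_le_of_rigidFor {P₀ : PeriodicConfiguration 3} (hP₀ : RigidFor P₀)
    (Q : PeriodicConfiguration 3) :
    P₀.energyPerParticle lennardJones ≤ Q.energyPerParticle lennardJones :=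
  (KeplerBoundBulk.isLeast_of_gsRigid
    (fun R ε hR hε => hP₀ R ε hR hε gs gs_injective excessVanishes_gs)).2 ⟨Q, rfl⟩

/-- **`SlackRigidity` pins the periodic minimisers** (registered stub
`slackRigidity_pins_minimisers` of crux stmt-AtomisticToContinuum-11960, a NECESSARY condition):
under the crux there is ONE periodic configuration `P` which is a periodic Lennard-Jones minimiser
and to which every periodic minimiser `Q` is two-way `ε`-congruent, up to a linear isometry, around
every site `s ∈ Q.points`, for all `R, ε > 0`. [folklore] -/
theorem slackRigidity_pins_minimisers :
    Summit.AtomisticToContinuum.Crystallization.Theses.ThreeConeCertificate.SlackRigidity →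
      ∃ P : PeriodicConfiguration 3,
        (∀ Q : PeriodicConfiguration 3,
          P.energyPerParticle lennardJones ≤ Q.energyPerParticle lennardJones) ∧
        ∀ Q : PeriodicConfiguration 3,
          (∀ Q' : PeriodicConfiguration 3,
            Q.energyPerParticle lennardJones ≤ Q'.energyPerParticle lennardJones) →
          ∀ s ∈ Q.points, ∀ R ε : ℝ, 0 < R → 0 < ε →
            ∃ A : EuclideanSpace ℝ (Fin 3) →ₗᵢ[ℝ] EuclideanSpace ℝ (Fin 3),
              (∀ p ∈ P.points, ‖p‖ ≤ R → ∃ q ∈ Q.points, dist q (s + A p) ≤ ε) ∧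
              (∀ q ∈ Q.points, dist q s ≤ R → ∃ p ∈ P.points, dist q (s + A p) ≤ ε) := by
  intro h
  obtain ⟨P₀, hP₀⟩ := slackRigidity_iff.1 h
  exact ⟨P₀, energyPerParticle_le_of_rigidFor hP₀,
    fun Q hQ s hs R ε hR hε => siteMatched_of_rigidFor hP₀ hQ hs hR hε⟩

end Summit.AtomisticToContinuum.Crystallization.Theorems.SlackRigidityPinsMinimisers

end
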